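import Summits.Parity.GeneralizedHardyLittlewood.Theses.PolymathEpsThreeCeiling

/-!
# Route `PolymathEpsThreeCeiling` — assembly item `Assembly` (stmt-Parity-19071)

`Assembly := GridBoundHigh → GridBoundLow → EpsThreeLeTwo`: the two grid bounds
`M_{3, j/80} ≤ 2(80+j)/(81+j)` (`j ≤ 16` from `GridBoundLow`, `17 ≤ j ≤ 40` from `GridBoundHigh`) and the landed
dilation chain `Literature.NumberTheory.Sieve.MkEps.dilationChain_holds` (p405742) give `M_{3,ε} ≤ 2` for every
`ε ∈ [0, 1/2]`: at `j = ⌊80ε⌋` the dilation `t ↦ ((1+ε)/(1+j/80)) • t` transports a test function for `ε` to one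
for `j/80` at cost `(1+ε)/(1+j/80)`, and `160(1+ε)/(81+j) ≤ 2 ⇔ 80ε ≤ j+1`, which is `Nat.lt_floor_add_one`.
Candidate term of record: planner p3 evidence `AssemblyM_holds.lean` (pub/parity-ideate/parity-ideate-p3/evidence2/,
sha16 aa45f46a3121db49), refuter re-check 2026-08-27 and writer g19 farm re-check 2026-08-31 rc 0; landed verbatim by
the decomp-parity landing hand leafhand-parity-fmcert-1 g0.  Rung F-P1 bookkeeping, no summit motion.
Standard axioms only.
-/

namespace Summit.Parity.GeneralizedHardyLittlewood.Theses.PolymathEpsThreeCeiling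

/-- **`Assembly` holds** (route `PolymathEpsThreeCeiling`, stmt-Parity-19071):
`GridBoundHigh → GridBoundLow → EpsThreeLeTwo` — merge the two grid bounds into
`∀ j ≤ 40, M_{3,j/80} ≤ 2(80+j)/(81+j)`, take `j = ⌊80ε⌋`, transport by `MkEps.dilationChain_holds`, and close with
`160(1+ε)/(81+j) ≤ 2`. -/
theorem assembly_holds : Summit.Parity.GeneralizedHardyLittlewood.Theses.PolymathEpsThreeCeiling.Assembly := by
  intro hH hL ε h0 h12 F hF
  have hgrid : ∀ j : ℕ, j ≤ 40 → ∀ ⦃G : (Fin 3 → ℝ) → ℝ⦄,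
      Literature.NumberTheory.Sieve.IsPolymathTestFunction 3 ((j : ℝ) / 80) G →
      Literature.NumberTheory.Sieve.polymathFunctional 3 ((j : ℝ) / 80) G ≤ 2 * (80 + j) / (81 + j) := by
    intro j hj G hG
    rcases le_or_gt j 16 with hj16 | hj16
    · exact hL j hj16 hG
    · exact hH j (by omega) hj hG
  set j : ℕ := ⌊80 * ε⌋₊ with hj
  have h80 : (0 : ℝ) ≤ 80 * ε := by positivity
  have hjle : (j : ℝ) ≤ 80 * ε := Nat.floor_le h80
  have hjlt : 80 * ε < (j : ℝ) + 1 := Nat.lt_floor_add_one (80 * ε)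
  have hj40 : j ≤ 40 := by
    have : (j : ℝ) ≤ 40 := by linarith
    exact_mod_cast this
  have ha0 : (0 : ℝ) ≤ (j : ℝ) / 80 := by positivity
  have haε : (j : ℝ) / 80 ≤ ε := by rw [div_le_iff₀ (by norm_num : (0:ℝ) < 80)]; linarith
  have hε1 : ε < 1 := by linarith
  obtain ⟨hG, hle⟩ := Literature.NumberTheory.Sieve.MkEps.dilationChain_holds ha0 haε hε1 hF
  have hb := hgrid j hj40 hG
  have hpos : (0 : ℝ) < 1 + (j : ℝ) / 80 := by positivity
  have hfac : 0 ≤ (1 + ε) / (1 + (j : ℝ) / 80) := div_nonneg (by linarith) hpos.le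
  calc Literature.NumberTheory.Sieve.polymathFunctional 3 ε F
      ≤ (1 + ε) / (1 + (j : ℝ) / 80) * Literature.NumberTheory.Sieve.polymathFunctional 3 ((j : ℝ) / 80)
          (fun t => F (((1 + ε) / (1 + (j : ℝ) / 80)) • t)) := hle
    _ ≤ (1 + ε) / (1 + (j : ℝ) / 80) * (2 * (80 + j) / (81 + j)) := mul_le_mul_of_nonneg_left hb hfac
    _ = 160 * (1 + ε) / (81 + j) := by field_simp; ring
    _ ≤ 2 := by rw [div_le_iff₀ (by positivity)]; linarith

end Summit.Parity.GeneralizedHardyLittlewood.Theses.PolymathEpsThreeCeiling
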